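import Literature.NumberTheory.LFunctions.MertensErrorTermsMeanValueRH
import Mathlib.MeasureTheory.Integral.Prod
import HarnessLib

/-!
# RH-EQUIVALENT literature, proof layer — «nothing here bears on the truth of RH»
# Zhao 2025, eq. (2.1): `∫₂^X E₁(x) dx = −X ∫_X^∞ (θ(t) − t) t⁻² dt + 2 log 2 − 2 + 2ℰ₁` (proved)

Proof companion of `MertensErrorTermsMeanValueRH.lean` (T. Zhao, Res. Number Theory 11 (2025) 62 = arXiv:2411.18903
[bib: `Zhao2025MertensMean`]); theorems only, no definition, no named fact.

§2 of the source integrates Mertens' first theorem in Rosser–Schoenfeld's form (the tree's `RosserSchoenfeld1962_eq_4_21`: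
`Σ_{p≤x}(log p)/p = log x + ℰ₁ + (θ(x) − x)/x − ∫_x^∞ (θ(y) − y) y⁻² dy`, `x ≥ 2`) and obtains the printed display (2.1)

  `∫₂^X E₁(x) dx = −X ∫_X^∞ (θ(x) − x) x⁻² dx + 2 log 2 − 2 + 2ℰ₁`,

«the integral above is the tail of the absolutely convergent integral `∫₂^∞ (θ(x) − x) x⁻² dx = log 2 − 1 + ℰ₁`».
This file PROVES (2.1) (`Zhao2025.integral_E₁_eq`, `Zhao2025.integral_E₁_eq'`): with `T(x) = ∫_x^∞ (θ − t)/t²`,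
`E₁(x) = (θ(x) − x)/x − T(x)`, `∫₂^X T = ∫₂^X (t − 2)(θ(t) − t)/t² dt + (X − 2) T(X)` (Fubini on the triangle
`2 < x < t ≤ X`), and the `∫ (θ(t) − t)/t` terms cancel. It is the first step of both directions of the source's
Thm 1 for `i = 1` (typed as the named fact `Zhao2025MertensMean_thm1`); the Landau step is not done here.
-/

noncomputable section

open Filter Topology Set MeasureTheory
open scoped Real Chebyshev

namespace Literature.NumberTheory.LFunctions

namespace Zhao2025

/-! ### The kernel `(θ(t) − t)/t²` and its tails -/

/-- The kernel `(θ(t) − t)/t²` is measurable (plumbing for the computation of (2.1)).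
[cite: Zhao2025MertensMean, §2 (after (2.1))] -/
theorem measurable_thetaKernel : Measurable fun t : ℝ => (θ t - t) / t ^ 2 :=
  (Mertens.measurable_theta.sub measurable_id).div (measurable_id.pow_const 2)

/-- The kernel is integrable on every `(x, ∞)`, `x ≥ 2` (tail of the absolutely convergent integral
`∫₂^∞ (θ(t) − t) t⁻² dt`, the tree's `Mertens.integrableOn_theta_sub_div_sq`). [cite: Zhao2025MertensMean, §2 (after (2.1))] -/
theorem integrableOn_thetaKernel_Ioi {x : ℝ} (hx : 2 ≤ x) :
    IntegrableOn (fun t : ℝ => (θ t - t) / t ^ 2) (Ioi x) :=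
  Mertens.integrableOn_theta_sub_div_sq.mono_set (Ioi_subset_Ioi hx)

/-- The kernel is integrable on every `(a, b]`, `a ≥ 2`. [cite: Zhao2025MertensMean, §2 (after (2.1))] -/
theorem integrableOn_thetaKernel_Ioc {a : ℝ} (b : ℝ) (ha : 2 ≤ a) :
    IntegrableOn (fun t : ℝ => (θ t - t) / t ^ 2) (Ioc a b) :=
  (integrableOn_thetaKernel_Ioi ha).mono_set Ioc_subset_Ioi_self

/-- The kernel is integrable on `[2, X]` (the endpoint is null). [cite: Zhao2025MertensMean, §2 (after (2.1))] -/
theorem integrableOn_thetaKernel_Icc (X : ℝ) :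
    IntegrableOn (fun t : ℝ => (θ t - t) / t ^ 2) (Icc 2 X) := by
  rw [integrableOn_Icc_iff_integrableOn_Ioc]
  exact integrableOn_thetaKernel_Ioc X le_rfl

/-- Interval integrability of the kernel on `[2, X]`. [cite: Zhao2025MertensMean, §2 (after (2.1))] -/
theorem intervalIntegrable_thetaKernel {X : ℝ} (hX : 2 ≤ X) :
    IntervalIntegrable (fun t : ℝ => (θ t - t) / t ^ 2) volume 2 X := by
  rw [intervalIntegrable_iff_integrableOn_Ioc_of_le hX]
  exact integrableOn_thetaKernel_Ioc X le_rfl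

/-- **Tail splitting**: for `2 ≤ x ≤ X`, `∫_x^∞ (θ−t)/t² = ∫_x^X (θ−t)/t² + ∫_X^∞ (θ−t)/t²`.
[cite: Zhao2025MertensMean, §2 (after (2.1))] -/
theorem tail_eq_intervalIntegral_add {x X : ℝ} (hx : 2 ≤ x) (hxX : x ≤ X) :
    ∫ t in Ioi x, (θ t - t) / t ^ 2 =
      (∫ t in x..X, (θ t - t) / t ^ 2) + ∫ t in Ioi X, (θ t - t) / t ^ 2 := by
  rw [← Ioc_union_Ioi_eq_Ioi hxX, setIntegral_union (Ioc_disjoint_Ioi le_rfl) measurableSet_Ioi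
    (integrableOn_thetaKernel_Ioc X hx) (integrableOn_thetaKernel_Ioi (hx.trans hxX)),
    intervalIntegral.integral_of_le hxX]

/-- **`E₁` through `θ`** (Rosser–Schoenfeld (4.21), the display before (2.1)): for `x ≥ 2`,
`E₁(x) = (θ(x) − x)/x − ∫_x^∞ (θ(t) − t) t⁻² dt`. [cite: Zhao2025MertensMean, §2 (display before (2.1))] -/
theorem E₁_eq_theta {x : ℝ} (hx : 2 ≤ x) :
    E₁ x = (θ x - x) / x - ∫ t in Ioi x, (θ t - t) / t ^ 2 := by
  have h := RosserSchoenfeld1962_eq_4_21 hx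
  unfold E₁ Mertens.primeLogDivSum
  linarith

/-- `|(θ(t) − t)/t| ≤ 3` for `t ≥ 2` (Chebyshev's bound `θ(t) ≤ t log 4`; plumbing for (2.1)).
[cite: Zhao2025MertensMean, §2 (after (2.1))] -/
theorem abs_theta_sub_div_le {t : ℝ} (ht : 2 ≤ t) : |(θ t - t) / t| ≤ 3 := by
  have ht0 : 0 < t := by linarith
  rw [abs_div, abs_of_pos ht0, div_le_iff₀ ht0]
  exact Mertens.abs_theta_sub_self_le ht0.le

/-- `t ↦ (θ(t) − t)/t` is integrable on `[2, X]` (plumbing for (2.1)).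
[cite: Zhao2025MertensMean, §2 (after (2.1))] -/
theorem intervalIntegrable_theta_sub_div {X : ℝ} (hX : 2 ≤ X) :
    IntervalIntegrable (fun t : ℝ => (θ t - t) / t) volume 2 X := by
  rw [intervalIntegrable_iff_integrableOn_Icc_of_le hX]
  have hmeas : Measurable fun t : ℝ => (θ t - t) / t :=
    (Mertens.measurable_theta.sub measurable_id).div measurable_id
  refine Integrable.mono' (g := fun _ => (3 : ℝ)) (integrableOn_const (by simp [Real.volume_Icc]))
    hmeas.aestronglyMeasurable ?_
  rw [ae_restrict_iff' measurableSet_Icc]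
  exact Eventually.of_forall fun t ht => by rw [Real.norm_eq_abs]; exact abs_theta_sub_div_le ht.1

/-! ### Fubini on the triangle -/

/-- **`∫₂^X (∫_x^X g) dx = ∫₂^X (t − 2) g(t) dt`** for the kernel `g = (θ − t)/t²` (Fubini on `2 < x < t ≤ X`).
[cite: Zhao2025MertensMean, §2 (partial summation leading to (2.1))] -/
theorem integral_integral_thetaKernel {X : ℝ} (hX : 2 ≤ X) :
    ∫ x in (2 : ℝ)..X, (∫ t in x..X, (θ t - t) / t ^ 2) =
      ∫ t in (2 : ℝ)..X, (t - 2) * ((θ t - t) / t ^ 2) := by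
  set g : ℝ → ℝ := fun t => (θ t - t) / t ^ 2 with hg
  set μ : Measure ℝ := volume.restrict (Ioc 2 X) with hμ
  haveI : IsFiniteMeasure μ := by
    rw [hμ]; exact ⟨by simp [Real.volume_Ioc]⟩
  have hgint : Integrable g μ := integrableOn_thetaKernel_Ioc X le_rfl
  -- the integrand of the double integral
  set F : ℝ → ℝ → ℝ := fun x t => if x < t then g t else 0 with hF
  have hFmeas : Measurable (Function.uncurry F) := by
    have : Function.uncurry F = fun p : ℝ × ℝ => if p.1 < p.2 then g p.2 else 0 := by
      funext p; rfl
    rw [this]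
    exact Measurable.ite (measurableSet_lt measurable_fst measurable_snd)
      (measurable_thetaKernel.comp measurable_snd) measurable_const
  have hFint : Integrable (Function.uncurry F) (μ.prod μ) := by
    refine (hgint.comp_snd μ).norm.mono' hFmeas.aestronglyMeasurable (Eventually.of_forall fun p => ?_)
    simp only [Function.uncurry, hF]
    split_ifs
    · exact le_rfl
    · simp
  have hswap := integral_integral_swap hFint
  -- left side: inner integral in `t` is `∫_x^X g`
  have hL : ∀ x ∈ Ioc (2 : ℝ) X, ∫ t, F x t ∂μ = ∫ t in x..X, g t := by
    intro x hx
    rw [intervalIntegral.integral_of_le hx.2, hμ]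
    have : ∀ t, F x t = (Ioi x).indicator g t := by
      intro t; simp only [hF, indicator, mem_Ioi]
    simp_rw [this]
    rw [integral_indicator measurableSet_Ioi, Measure.restrict_restrict measurableSet_Ioi]
    have hset : Ioi x ∩ Ioc 2 X = Ioc x X := by
      ext t
      simp only [mem_inter_iff, mem_Ioi, mem_Ioc]
      constructor
      · rintro ⟨h1, -, h3⟩; exact ⟨h1, h3⟩
      · rintro ⟨h1, h3⟩; exact ⟨h1, by linarith [hx.1], h3⟩
    rw [hset]
  -- right side: inner integral in `x` is `(t - 2) g t`
  have hR : ∀ t ∈ Ioc (2 : ℝ) X, ∫ x, F x t ∂μ = (t - 2) * g t := by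
    intro t ht
    have : ∀ x, F x t = (Iio t).indicator (fun _ => g t) x := by
      intro x; simp only [hF, indicator, mem_Iio]
    simp_rw [this]
    rw [integral_indicator_const _ measurableSet_Iio, smul_eq_mul, hμ, measureReal_restrict_apply measurableSet_Iio]
    have hset : Iio t ∩ Ioc 2 X = Ioo 2 t := by
      ext x; simp only [mem_inter_iff, mem_Iio, mem_Ioc, mem_Ioo]
      constructor
      · rintro ⟨h1, h2, -⟩; exact ⟨h2, h1⟩
      · rintro ⟨h1, h2⟩; exact ⟨h2, h1, h2.le.trans ht.2⟩
    rw [hset, Real.volume_real_Ioo_of_le ht.1.le]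
  -- assemble
  rw [intervalIntegral.integral_of_le hX, intervalIntegral.integral_of_le hX]
  have e1 : ∫ x in Ioc 2 X, (∫ t in x..X, g t) = ∫ x, (∫ t, F x t ∂μ) ∂μ := by
    rw [hμ]; exact (setIntegral_congr_fun measurableSet_Ioc hL).symm
  have e2 : ∫ t in Ioc 2 X, (t - 2) * g t = ∫ t, (∫ x, F x t ∂μ) ∂μ := by
    rw [hμ]; exact (setIntegral_congr_fun measurableSet_Ioc hR).symm
  rw [e1, e2, hswap]

/-! ### The identity (2.1) -/

/-- **Zhao 2025, eq. (2.1), PROVED**: for `X ≥ 2`,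
`∫₂^X E₁(x) dx = 2 ∫₂^∞ (θ(t) − t) t⁻² dt − X ∫_X^∞ (θ(t) − t) t⁻² dt`.
[cite: Zhao2025MertensMean, §2 eq. (2.1)] -/
theorem integral_E₁_eq {X : ℝ} (hX : 2 ≤ X) :
    ∫ x in (2 : ℝ)..X, E₁ x =
      2 * (∫ t in Ioi (2 : ℝ), (θ t - t) / t ^ 2) - X * ∫ t in Ioi X, (θ t - t) / t ^ 2 := by
  set g : ℝ → ℝ := fun t => (θ t - t) / t ^ 2 with hg
  set TX : ℝ := ∫ t in Ioi X, g t with hTX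
  set C : ℝ := ∫ t in Ioi (2 : ℝ), g t with hC
  -- `E₁ = (θ − x)/x − ∫_x^X g − T(X)` on `[2, X]`
  have hE : EqOn E₁ (fun x => (θ x - x) / x - (∫ t in x..X, g t) - TX) (uIcc 2 X) := by
    intro x hx
    rw [uIcc_of_le hX] at hx
    simp only
    rw [E₁_eq_theta hx.1, tail_eq_intervalIntegral_add hx.1 hx.2]
    ring
  -- integrability of the three pieces
  have h1 : IntervalIntegrable (fun x : ℝ => (θ x - x) / x) volume 2 X := intervalIntegrable_theta_sub_div hX
  have h2 : IntervalIntegrable (fun x : ℝ => ∫ t in x..X, g t) volume 2 X := by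
    refine ContinuousOn.intervalIntegrable ?_
    have := intervalIntegral.continuousOn_primitive_interval_left (μ := volume) (f := g) (a := 2) (b := X)
      (by rw [uIcc_of_le hX]; exact integrableOn_thetaKernel_Icc X)
    exact this
  have h3 : IntervalIntegrable (fun _ : ℝ => TX) volume 2 X := intervalIntegrable_const
  rw [intervalIntegral.integral_congr hE, intervalIntegral.integral_sub (h1.sub h2) h3,
    intervalIntegral.integral_sub h1 h2, intervalIntegral.integral_const, smul_eq_mul,
    integral_integral_thetaKernel hX]
  -- `∫₂^X (t − 2) g = ∫₂^X (θ − t)/t − 2 ∫₂^X g`, and `∫₂^X g = C − T(X)`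
  have h4 : ∫ t in (2 : ℝ)..X, (t - 2) * g t = (∫ t in (2 : ℝ)..X, (θ t - t) / t) - 2 * ∫ t in (2 : ℝ)..X, g t := by
    have hcongr : EqOn (fun t : ℝ => (t - 2) * g t) (fun t => (θ t - t) / t - 2 * g t) (uIcc 2 X) := by
      intro t ht
      rw [uIcc_of_le hX] at ht
      have ht0 : t ≠ 0 := by linarith [ht.1]
      simp only [hg]
      field_simp
    rw [intervalIntegral.integral_congr hcongr, intervalIntegral.integral_sub h1
      ((intervalIntegrable_thetaKernel hX).const_mul 2), intervalIntegral.integral_const_mul]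
  have h5 : ∫ t in (2 : ℝ)..X, g t = C - TX := by
    have := tail_eq_intervalIntegral_add (le_refl (2 : ℝ)) hX
    rw [hC, hTX]; linarith
  rw [h4, h5]
  ring

/-- **(2.1) with the printed constant**: `∫₂^X E₁ = −X ∫_X^∞ (θ − t)/t² + 2 log 2 − 2 + 2ℰ₁` (`ℰ₁ = rosserSchoenfeldE`;
`∫₂^∞ (θ − t)/t² = log 2 − 1 + ℰ₁` is the tree's `rosserSchoenfeldE_eq_integral`). [cite: Zhao2025MertensMean, §2 eq. (2.1)] -/
theorem integral_E₁_eq' {X : ℝ} (hX : 2 ≤ X) :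
    ∫ x in (2 : ℝ)..X, E₁ x =
      -X * (∫ t in Ioi X, (θ t - t) / t ^ 2) + (2 * Real.log 2 - 2 + 2 * rosserSchoenfeldE) := by
  rw [integral_E₁_eq hX, rosserSchoenfeldE_eq_integral]
  ring

end Zhao2025

end Literature.NumberTheory.LFunctions

end
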